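import Summits.ResolutionOfSingularities.ResolutionOfSingularities.Theorems.EquisingularLiftEquisingularLiftNatCarrierDeltaHDeltaTC3
import Literature.AlgebraicGeometry.Resolution.AlterationsNodalFibre
import Literature.AlgebraicGeometry.Resolution.BlowupStalkBlowupAlgebra
import Literature.AlgebraicGeometry.Resolution.BlowupAlgebraPresentation
import HarnessLib

/-!
# [OURS · L1 W4.5(b)] T-FRAME-AT — the section frame ADAPTED to a closed point of the exceptional divisor (`q′ = [1:0:0]`)

Support file of the crux chain w45b (cell `res-hironaka`, slot W4.5(b)), working crux **EL♮** (stmt-ResolutionOfSingularities-20038,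
child EL♮(3) stmt-20148), rung v7/v8 `stub_elnat_tcPlusPointResolution`; brick «T-FRAME-AT» of res-L1-w45b-stub-1's
HSUB(ReachTC⁺)₃ assembly (STATUS 2026-08-27T10:44:46Z, Q1). OURS; NOT a statement of any manuscript; AI-written.
Filed `--supports stmt-ResolutionOfSingularities-20038 --as helper`.

In the HΔTC situation (model square `IsPullback j t r' (Spec θ)` over a DVR `O ↠ k`, `k` algebraically closed, a section `s` of `r'`
through `s(s₀) = j x`, `𝒪_{X',j x}` regular of dimension `3 + 1`) and for the blow-up `υ : F₂ → F₁` of the reduced closed point `x`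
and a CLOSED point `q′ ∈ υ⁻¹ x`, `exists_sectionFrame_adapted` produces a section frame `c = (c₀, c₁, c₂)` at `j x` (all six clauses
of res-type-100's `exists_sectionFrame_forall_dim_at`) together with a chart presentation of `𝒪_{F₂,q′}` ON THE CHART `c̄₀ ≠ 0`
(`c̄ = j^♯ c`) in which the two chart coordinates `c̄₁/c̄₀`, `c̄₂/c̄₀` VANISH at `q′` — i.e. `q′ = [1:0:0]` in the frame `c̄`.
Route: any frame; a presentation of `q′` on some chart `jj` (`IsBlowup.exists_blowupAlgebra_stalk_ringEquiv`); the VALUES of the chart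
coordinates at `q′` are constants (`exists_sub_algebraMap_mem_of_isClosed`: `κ(x) → κ(q′)` is onto over an algebraically closed
field, Literature `residueFieldMap_surjective_of_isClosed`); translate the frame by their lifts and swap `0 ↔ jj` (the ideal `(c)` is
unchanged, so every frame clause is regenerated by `exists_sectionFrame_of_span_eq_forall`); the presentation is transported to the
new chart algebra (same ideal, same exceptional generator: `blowupAlgebra_presentation_transport`).
-/

set_option linter.dupNamespace false -- mandated namespace `Summit.<Summit>.<Problem>` of this single-conjunct summit
set_option linter.overlappingInstances false -- signatures carry `[IsDomain O] [IsDiscreteValuationRing O]`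

noncomputable section

open CategoryTheory CategoryTheory.Limits AlgebraicGeometry TopologicalSpace IsLocalRing
open Literature.AlgebraicGeometry.Resolution
open AlgebraicGeometry.Scheme.IdealSheafData

namespace Summit.ResolutionOfSingularities.ResolutionOfSingularities.Cruxes.EquisingularLiftNat.Sections

universe u

/-! ## Values at a closed point -/

/-- **Values at a closed point of the blow-up.** Over an algebraically closed field `k` (everything locally of finite type), for a
closed point `q` of `F₂` over the closed point `υ q` of `F₁` and ANY presentation `χ : B → 𝒪_{F₂,q}` of the local ring as a
localisation of an `𝒪_{F₁,υ q}`-algebra `B` at a prime `𝔔` (`χ` extending `υ^♯_q`): every `b ∈ B` is congruent modulo `𝔔` to a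
constant `a ∈ 𝒪_{F₁,υ q}` — its VALUE at `q` (`κ(υ q) → κ(q)` is onto, `residueFieldMap_surjective_of_isClosed`). [folklore] -/
theorem exists_sub_algebraMap_mem_of_isClosed {k : Type u} [Field k] [IsAlgClosed k] {F₁ F₂ : Scheme.{u}}
    (υ : F₂ ⟶ F₁) (g : F₁ ⟶ Spec (.of k)) [LocallyOfFiniteType g] [LocallyOfFiniteType (υ ≫ g)]
    (q : F₂) (hq : IsClosed ({q} : Set F₂)) (hx : IsClosed ({υ q} : Set F₁))
    {B : Type u} [CommRing B] [Algebra (F₁.presheaf.stalk (υ q)) B] (𝔔 : Ideal B) [𝔔.IsPrime]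
    (χ : B →+* F₂.presheaf.stalk q) (hχ : ∀ a, χ (algebraMap _ B a) = (υ.stalkMap q).hom a)
    (hloc : @IsLocalization.AtPrime _ _ (F₂.presheaf.stalk q) _ χ.toAlgebra 𝔔 _) (b : B) :
    ∃ a : F₁.presheaf.stalk (υ q), b - algebraMap _ B a ∈ 𝔔 := by
  obtain ⟨r, hr⟩ := residueFieldMap_surjective_of_isClosed υ g hq hx ((F₂.residue q).hom (χ b))
  obtain ⟨a, rfl⟩ := Ideal.Quotient.mk_surjective r
  refine ⟨a, ?_⟩
  have h1 : (υ.residueFieldMap q).hom ((F₁.residue (υ q)).hom a) = (F₂.residue q).hom ((υ.stalkMap q).hom a) := by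
    rw [← CommRingCat.comp_apply, Scheme.residue_residueFieldMap, CommRingCat.comp_apply]
  have h2 : (F₂.residue q).hom ((υ.stalkMap q).hom a) = (F₂.residue q).hom (χ b) := h1.symm.trans hr
  have h3 : χ b - (υ.stalkMap q).hom a ∈ maximalIdeal (F₂.presheaf.stalk q) := by
    rw [← Ideal.Quotient.eq]
    exact h2.symm
  rw [← hχ, ← map_sub] at h3
  letI := χ.toAlgebra
  exact (IsLocalization.AtPrime.to_map_mem_maximal_iff (F₂.presheaf.stalk q) 𝔔 (b - algebraMap _ B a)).mp h3

/-! ## Transport of chart presentations along `(I, a) = (I′, a′)` -/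

/-- A chart presentation of a local ring `S` on `R[I/a]` — prime `𝔔`, structure map `χ` extending `φ : R → S`, localisation, the
isomorphism `S ≅ R[I/a]_𝔔`, `𝔔 ∩ R = 𝔪_R`, and a family of elements given by their NUMERATORS that lie in `𝔔` — transports
verbatim to `R[I′/a′]` when `I′ = I` and `a′ = a`. [folklore] -/
theorem blowupAlgebra_presentation_transport {R S : Type u} [CommRing R] [CommRing S] [IsLocalRing R] [IsLocalRing S]
    (φ : R →+* S) {I I' : Ideal R} (hI : I' = I) {a a' : R} (ha : a' = a) {ι : Type*} (num : ι → R)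
    (H : ∃ (𝔔 : PrimeSpectrum (blowupAlgebra I a)) (χ : blowupAlgebra I a →+* S) (e : S ≃+* Localization.AtPrime 𝔔.asIdeal),
      (∀ r, χ (algebraMap R _ r) = φ r) ∧ @IsLocalization.AtPrime _ _ S _ χ.toAlgebra 𝔔.asIdeal _ ∧
      (∀ b, e (χ b) = algebraMap _ (Localization.AtPrime 𝔔.asIdeal) b) ∧
      𝔔.asIdeal.comap (algebraMap R (blowupAlgebra I a)) = maximalIdeal R ∧
      ∀ (l : ι) (y : blowupAlgebra I a),
        (y : Localization.Away a) = algebraMap R (Localization.Away a) (num l) * IsLocalization.Away.invSelf a → y ∈ 𝔔.asIdeal) :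
    ∃ (𝔔 : PrimeSpectrum (blowupAlgebra I' a')) (χ : blowupAlgebra I' a' →+* S) (e : S ≃+* Localization.AtPrime 𝔔.asIdeal),
      (∀ r, χ (algebraMap R _ r) = φ r) ∧ @IsLocalization.AtPrime _ _ S _ χ.toAlgebra 𝔔.asIdeal _ ∧
      (∀ b, e (χ b) = algebraMap _ (Localization.AtPrime 𝔔.asIdeal) b) ∧
      𝔔.asIdeal.comap (algebraMap R (blowupAlgebra I' a')) = maximalIdeal R ∧
      ∀ (l : ι) (y : blowupAlgebra I' a'),
        (y : Localization.Away a') = algebraMap R (Localization.Away a') (num l) * IsLocalization.Away.invSelf a' →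
          y ∈ 𝔔.asIdeal := by
  subst hI ha
  exact H

/-! ## Translating and swapping a frame -/

/-- **Adapted coordinates.** From coordinates `c₀`, a chart index `jj` and constants `w` (lifts of the values `a`): the family
`c` obtained by `c₀_l ↦ c₀_l - w_l c₀_jj` (`l ≠ jj`) and swapping `0 ↔ jj` generates the same ideal, has `c 0 = c₀ jj`, and for
`l ≠ 0` its image is `f c₀_m - a_m · f c₀_jj` for some `m ≠ jj`. [folklore] -/
theorem exists_translate_swap_coords {R S : Type*} [CommRing R] [CommRing S] (f : R →+* S) {r : ℕ}
    (c₀ : Fin (r + 1) → R) (jj : Fin (r + 1)) (w : Fin (r + 1) → R) (a : Fin (r + 1) → S) (hw : ∀ l, f (w l) = a l) :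
    ∃ c : Fin (r + 1) → R, Ideal.span (Set.range c) = Ideal.span (Set.range c₀) ∧ c 0 = c₀ jj ∧
      ∀ l : Fin (r + 1), l ≠ 0 → ∃ m, m ≠ jj ∧ f (c l) = f (c₀ m) - a m * f (c₀ jj) := by
  classical
  set c₁ : Fin (r + 1) → R := fun l => c₀ l - Function.update w jj 0 l * c₀ jj with hc₁
  have hc₁jj : c₁ jj = c₀ jj := by simp [hc₁]
  have hspan₁ : Ideal.span (Set.range c₁) = Ideal.span (Set.range c₀) := by
    apply le_antisymm
    · rw [Ideal.span_le]
      rintro _ ⟨l, rfl⟩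
      exact Ideal.sub_mem _ (Ideal.subset_span ⟨l, rfl⟩) (Ideal.mul_mem_left _ _ (Ideal.subset_span ⟨jj, rfl⟩))
    · rw [Ideal.span_le]
      rintro _ ⟨l, rfl⟩
      have h : c₀ l = c₁ l + Function.update w jj 0 l * c₁ jj := by rw [hc₁jj]; simp [hc₁]
      rw [SetLike.mem_coe, h]
      exact Ideal.add_mem _ (Ideal.subset_span ⟨l, rfl⟩) (Ideal.mul_mem_left _ _ (Ideal.subset_span ⟨jj, rfl⟩))
  refine ⟨c₁ ∘ Equiv.swap 0 jj, by rw [(Equiv.swap 0 jj).surjective.range_comp, hspan₁],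
    by rw [Function.comp_apply, Equiv.swap_apply_left, hc₁jj], fun l hl => ⟨Equiv.swap 0 jj l, ?_, ?_⟩⟩
  · intro h
    apply hl
    have := congrArg (Equiv.swap 0 jj) h
    rwa [Equiv.swap_apply_self, Equiv.swap_apply_right] at this
  · have hm : Equiv.swap 0 jj l ≠ jj := by
      intro h
      apply hl
      have := congrArg (Equiv.swap 0 jj) h
      rwa [Equiv.swap_apply_self, Equiv.swap_apply_right] at this
    rw [Function.comp_apply, hc₁]
    simp only [map_sub, map_mul, Function.update_of_ne hm, hw]

/-- In `R[I/xᵢ]`: the element with numerator `x_m - a·xᵢ` is `x_m/xᵢ - a`. [folklore] -/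
theorem blowupAlgebra_eq_frac_sub_algebraMap {R : Type u} [CommRing R] {r : ℕ} (x : Fin r → R) (i m : Fin r) (a : R)
    (y : blowupAlgebra (Ideal.span (Set.range x)) (x i))
    (hy : (y : Localization.Away (x i)) =
      algebraMap R (Localization.Away (x i)) (x m - a * x i) * IsLocalization.Away.invSelf (x i)) :
    y = blowupAlgebra.frac x i m - algebraMap R _ a := by
  apply Subtype.ext
  rw [hy, Subalgebra.coe_sub, blowupAlgebra.coe_frac, Subalgebra.coe_algebraMap, map_sub, map_mul, sub_mul, mul_assoc,
    IsLocalization.Away.mul_invSelf, mul_one]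

variable (O : Type) [CommRing O] [IsDomain O] [IsDiscreteValuationRing O]

/-- The frame of GIVEN coordinates at a NAMED point `p` with `s(s₀) = p` (`exists_sectionFrame_of_span_eq_forall` by `subst`).
[cite: Matsumura1987, Thm. 14.2] -/
theorem exists_sectionFrame_of_span_eq_forall_at {P : Scheme.{0}} (q : P ⟶ Spec (.of O)) [IsSeparated q]
    (s : Spec (.of O) ⟶ P) (hs : s ≫ q = 𝟙 _) (p : P) (hp : s (IsLocalRing.closedPoint O) = p)
    (hreg : IsRegularLocalRing (P.presheaf.stalk p)) (ϖ : O) (hϖ : Irreducible ϖ) {n : ℕ} (c : Fin n → P.presheaf.stalk p)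
    (hcI : Ideal.span (Set.range c) = stalkIdeal s.ker p) (hdim : ringKrullDim (P.presheaf.stalk p) = (n + 1 : ℕ)) :
    ∃ (θ : (P.presheaf.stalk p ⧸ Ideal.span (Set.range c)) ≃+* O),
      IsQuasiRegular c ∧ IsDomain (P.presheaf.stalk p ⧸ Ideal.span (Set.range c)) ∧
      (∀ b : O, θ (Ideal.Quotient.mk _ ((P.presheaf.Γgerm p).hom (q.appTop.hom ((Scheme.ΓSpecIso (.of O)).inv.hom b)))) = b) ∧
      Ideal.span (Set.range c) ⊔ Ideal.span {(P.presheaf.Γgerm p).hom (q.appTop.hom ((Scheme.ΓSpecIso (.of O)).inv.hom ϖ))} =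
        maximalIdeal (P.presheaf.stalk p) ∧
      (P.presheaf.Γgerm p).hom (q.appTop.hom ((Scheme.ΓSpecIso (.of O)).inv.hom ϖ)) ∉ Ideal.span (Set.range c) := by
  subst hp
  exact exists_sectionFrame_of_span_eq_forall O q s hs hreg ϖ hϖ c hcI hdim

/-! ## T-FRAME-AT -/

set_option maxHeartbeats 800000 in -- chart algebra of a stalk = subalgebra of a localisation: slow instance unification (as p509910)
/-- **T-FRAME-AT: the section frame adapted to a closed point `q′` of the exceptional divisor.** In the model square over a DVR
`O ↠ k` (`k` algebraically closed, `r'` separated and locally of finite type) with a section `s` through `s(s₀) = j x` (`x` closed,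
`𝒪_{X',j x}` regular of dimension `3 + 1`), let `υ : F₂ → F₁` be the blow-up of the reduced point `x` and `q′ ∈ F₂` a CLOSED point
over `x`. Then there is a section frame `c = (c₀, c₁, c₂)` at `j x` — `(c) = 𝓘(s)_{j x}`, quasi-regular, `𝒪/(c) ≅ O` a domain and the
identity on constants, `(c) + (ϖ) = 𝔪`, `ϖ ∉ (c)` — and a presentation of `𝒪_{F₂,q′}` as a localisation of the chart algebra
`𝒪_{F₁,x}[𝔪_x/c̄₀]` (`c̄ = j^♯ c`) at a prime `𝔔` over `𝔪_x`, with `χ` extending `υ^♯_{q′}` (through `𝒪_{F₁,x} ≅ 𝒪_{F₁,υ q′}`), such that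
the chart coordinates `c̄₁/c̄₀`, `c̄₂/c̄₀` lie in `𝔔`: **`q′ = [1:0:0]`**. [cite: StacksProject, Tag 0804] -/
theorem exists_sectionFrame_adapted (k : Type) [Field k] [IsAlgClosed k] (θ : O →+* k) (hθ : Function.Surjective θ)
    {X' F₁ F₂ : Scheme.{0}} (r' : X' ⟶ Spec (.of O)) [IsSeparated r'] [LocallyOfFiniteType r'] [IsLocallyNoetherian X']
    (s : Spec (.of O) ⟶ X') (hs : s ≫ r' = 𝟙 _) (j : F₁ ⟶ X') (t : F₁ ⟶ Spec (.of k))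
    (hsq : IsPullback j t r' (Spec.map (CommRingCat.ofHom θ))) (x : F₁) (hx : IsClosed ({x} : Set F₁))
    (hss : s (IsLocalRing.closedPoint O) = j x) (hreg : IsRegularLocalRing (X'.presheaf.stalk (j x)))
    (hdim : ringKrullDim (X'.presheaf.stalk (j x)) = ((3 + 1 : ℕ) : WithBot ℕ∞)) (ϖ : O) (hϖ : Irreducible ϖ)
    (υ : F₂ ⟶ F₁) (hυ : IsBlowup υ (vanishingIdeal ⟨{x}, hx⟩)) (q' : F₂) (hq' : υ q' = x)
    (hq'c : IsClosed ({q'} : Set F₂)) :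
    ∃ (c : Fin 3 → X'.presheaf.stalk (j x)) (θR : (X'.presheaf.stalk (j x) ⧸ Ideal.span (Set.range c)) ≃+* O),
      Ideal.span (Set.range c) = stalkIdeal s.ker (j x) ∧ IsQuasiRegular c ∧
      IsDomain (X'.presheaf.stalk (j x) ⧸ Ideal.span (Set.range c)) ∧
      (∀ b : O, θR (Ideal.Quotient.mk _ ((X'.presheaf.Γgerm (j x)).hom
        (r'.appTop.hom ((Scheme.ΓSpecIso (.of O)).inv.hom b)))) = b) ∧
      Ideal.span (Set.range c) ⊔ Ideal.span {(X'.presheaf.Γgerm (j x)).hom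
        (r'.appTop.hom ((Scheme.ΓSpecIso (.of O)).inv.hom ϖ))} = maximalIdeal (X'.presheaf.stalk (j x)) ∧
      (X'.presheaf.Γgerm (j x)).hom (r'.appTop.hom ((Scheme.ΓSpecIso (.of O)).inv.hom ϖ)) ∉ Ideal.span (Set.range c) ∧
      ∃ (𝔔 : PrimeSpectrum (blowupAlgebra (Ideal.span (Set.range fun i => (j.stalkMap x).hom (c i)))
          ((j.stalkMap x).hom (c 0))))
        (χ : blowupAlgebra (Ideal.span (Set.range fun i => (j.stalkMap x).hom (c i))) ((j.stalkMap x).hom (c 0)) →+*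
          F₂.presheaf.stalk q')
        (e : F₂.presheaf.stalk q' ≃+* Localization.AtPrime 𝔔.asIdeal),
        (∀ a, χ (algebraMap _ _ a) =
          ((F₁.presheaf.stalkCongr (Inseparable.of_eq hq')).inv ≫ υ.stalkMap q').hom a) ∧
        @IsLocalization.AtPrime _ _ (F₂.presheaf.stalk q') _ χ.toAlgebra 𝔔.asIdeal _ ∧
        (∀ b, e (χ b) = algebraMap _ (Localization.AtPrime 𝔔.asIdeal) b) ∧
        𝔔.asIdeal.comap (algebraMap _ (blowupAlgebra (Ideal.span (Set.range fun i => (j.stalkMap x).hom (c i)))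
          ((j.stalkMap x).hom (c 0)))) = maximalIdeal (F₁.presheaf.stalk x) ∧
        ∀ (l : {l : Fin 3 // l ≠ 0}) (y : blowupAlgebra (Ideal.span (Set.range fun i => (j.stalkMap x).hom (c i)))
            ((j.stalkMap x).hom (c 0))),
          (y : Localization.Away ((j.stalkMap x).hom (c 0))) =
            algebraMap _ (Localization.Away ((j.stalkMap x).hom (c 0))) ((j.stalkMap x).hom (c l.1)) *
              IsLocalization.Away.invSelf ((j.stalkMap x).hom (c 0)) → y ∈ 𝔔.asIdeal := by
  classical
  subst hq'
  haveI : IsClosedImmersion (Spec.map (CommRingCat.ofHom θ)) := IsClosedImmersion.spec_of_surjective _ hθ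
  haveI : IsClosedImmersion j := MorphismProperty.IsStableUnderBaseChange.of_isPullback hsq.flip inferInstance
  haveI : LocallyOfFiniteType t := MorphismProperty.IsStableUnderBaseChange.of_isPullback hsq inferInstance
  haveI : IsLocallyNoetherian F₁ := LocallyOfFiniteType.isLocallyNoetherian j
  haveI : IsProper υ := hυ.isProper
  have hϖO : ϖ ∈ maximalIdeal O := by rw [hϖ.maximalIdeal_eq]; exact Ideal.mem_span_singleton_self ϖ
  -- (1) any frame
  obtain ⟨n, c₀, θ₀, hcI₀, -, -, -, h𝔪₀, -, hdimn⟩ :=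
    exists_sectionFrame_forall_dim_at O r' s hs (j (υ q')) hss hreg ϖ hϖ
  have hn : n + 1 = 3 + 1 := by
    have h := hdimn.symm.trans hdim
    exact_mod_cast h
  obtain rfl : n = 3 := by omega
  have hcb₀𝔪 := span_stalkMap_eq_maximalIdeal_of_model θ hθ r' j t hsq (υ q') ϖ hϖO c₀ h𝔪₀
  have hcb₀J : Ideal.span (Set.range fun i => (j.stalkMap (υ q')).hom (c₀ i)) =
      stalkIdeal (vanishingIdeal ⟨{υ q'}, hx⟩) (υ q') := by
    rw [hcb₀𝔪, stalkIdeal_vanishingIdeal_singleton hx]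
  -- (2) a presentation of `q'` on some chart `jj`, and the values of the chart coordinates at `q'`
  have Hpres := hυ.exists_blowupAlgebra_stalk_ringEquiv q' (fun i => (j.stalkMap (υ q')).hom (c₀ i)) hcb₀J
  refine Hpres.elim fun jj H => H.elim fun 𝔔 H => H.elim fun χ H => H.elim fun e H => ?_
  have hχ := H.1
  have hloc := H.2.1
  have he := H.2.2.1
  have h𝔔 := H.2.2.2
  choose a ha using fun l : Fin 3 => exists_sub_algebraMap_mem_of_isClosed υ t q' hq'c hx 𝔔.asIdeal χ hχ hloc
    (blowupAlgebra.frac (fun i => (j.stalkMap (υ q')).hom (c₀ i)) jj l)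
  choose w hw using fun l : Fin 3 => stalkMap_model_surjective θ hθ r' j t hsq (υ q') (a l)
  -- (3) the translated and swapped frame (only `refine`/`have` at top level: the goal is large)
  refine (exists_translate_swap_coords (j.stalkMap (υ q')).hom c₀ jj w a hw).elim fun c hcp => ?_
  have hcI : Ideal.span (Set.range c) = stalkIdeal s.ker (j (υ q')) := hcp.1.trans hcI₀
  refine (exists_sectionFrame_of_span_eq_forall_at O r' s hs (j (υ q')) hss hreg ϖ hϖ c hcI hdim).elim fun θR hfr => ?_
  refine ⟨c, θR, hcI, hfr.1, hfr.2.1, hfr.2.2.1, hfr.2.2.2.1, hfr.2.2.2.2, ?_⟩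
  -- (4) the presentation, transported to the chart algebra of the new frame
  have hIeq : Ideal.span (Set.range fun i => (j.stalkMap (υ q')).hom (c i)) =
      Ideal.span (Set.range fun i => (j.stalkMap (υ q')).hom (c₀ i)) := by
    have h1 : (Set.range fun i => (j.stalkMap (υ q')).hom (c i)) = (j.stalkMap (υ q')).hom '' Set.range c :=
      Set.range_comp _ _
    have h2 : (Set.range fun i => (j.stalkMap (υ q')).hom (c₀ i)) = (j.stalkMap (υ q')).hom '' Set.range c₀ :=
      Set.range_comp _ _
    rw [h1, h2, ← Ideal.map_span, ← Ideal.map_span, hcp.1]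
  have haeq : (j.stalkMap (υ q')).hom (c 0) = (j.stalkMap (υ q')).hom (c₀ jj) := by rw [hcp.2.1]
  have hφ : ∀ a', ((F₁.presheaf.stalkCongr (Inseparable.of_eq (rfl : υ q' = υ q'))).inv ≫ υ.stalkMap q').hom a' =
      (υ.stalkMap q').hom a' := fun a' => by
    simp [TopCat.Presheaf.stalkCongr]
  refine blowupAlgebra_presentation_transport _ hIeq haeq (fun l : {l : Fin 3 // l ≠ 0} => (j.stalkMap (υ q')).hom (c l.1))
    ⟨𝔔, χ, e, fun a' => (hχ a').trans (hφ a').symm, hloc, he, h𝔔, fun l y hy => ?_⟩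
  -- the element with numerator `c̄_l`, `l ≠ 0`, of the old chart algebra is `c̄₀_m/c̄₀_jj - a_m`, `m ≠ jj`
  refine (hcp.2.2 l.1 l.2).elim fun m hm => ?_
  rw [hm.2] at hy
  have hy' := blowupAlgebra_eq_frac_sub_algebraMap (fun i => (j.stalkMap (υ q')).hom (c₀ i)) jj m (a m) y hy
  rw [hy']
  exact ha m

end Summit.ResolutionOfSingularities.ResolutionOfSingularities.Cruxes.EquisingularLiftNat.Sections

end
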